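import Literature.Analysis.FluidPDE.TaoClassGlue
import HarnessLib

/-!
# From Tao-class solutions on every finite slab to a global classical solution

Analysis/FluidPDE support file (global assembly step for the global regularity theorem of
Ladyzhenskaya and Ukhovskii–Yudovich for axisymmetric Navier–Stokes flows without swirl,
`Literature.Analysis.FluidPDE.axisymmetric_no_swirl_global_regularity`, `Axisymmetric.lean`;
Lemarié-Rieusset 2016, Thm. 10.4). It is pure bookkeeping on Tao's smooth `H¹` class
`IsTaoSolutionOn T ν u₀ u p` (`TaoClassGlue.lean`; Tao 2013, Thm. 5.4): once a Tao-class solution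
from the datum `u₀` is known on `[0, n + 1]` for **every** `n : ℕ` (say `(U n, P n)`), the fields

  `u t := U ⌊t⌋₊ t`, `p t := P ⌊t⌋₊ t`

form a classical solution of the unforced Navier–Stokes system on `[0, ∞) × ℝ³`
(`Fluid.IsClassicalNSSolutionOn (Ici 0)`, Fefferman's class (A): jointly smooth up to `t = 0`)
with `u 0 = u₀` and bounded energy `∫ |u(t)|² ≤ ∫ |u₀|²` (`NS.HasBoundedEnergy`)
(`IsTaoSolutionOn.global_of_nat`). The point is that the `(U n, P n)` are pairwise consistent:
velocities agree on the common slab by Prodi–Serrin weak–strong uniqueness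
(`IsTaoSolutionOn.eq_of_isTaoSolutionOn`) and then so do the `L²` pressures
(`IsTaoSolutionOn.pressure_eq`), so `u = U N`, `p = P N` on `[0, N + 1)` for every `N`
(`IsTaoSolutionOn.floor_eq`), and being a classical solution on `[0, ∞)` is a local property
along the exhaustion `[0, ∞) = ⋃ₙ [0, n + 1)` (`IsClassicalNSSolutionOn.of_forall_Ico_nat`).
This is the last step of every "local existence + a-priori bound ⇒ global smooth solution"
argument (Lemarié-Rieusset 2016, proof of Thm. 7.2, p. 147, and Thm. 10.4, p. 285: the maximal
time is `+∞`; Tao 2013, Cor. 5.? "maximal Cauchy development", arXiv Cor. 35); it involves no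
analysis beyond the cited uniqueness theorem, which is proved in the tree.

## Main statements (all proved)

* `IsClassicalNSSolutionOn.congr_slices`: the notion depends only on the slices `u t`, `p t`,
  `t ∈ S`.
* `IsClassicalNSSolutionOn.of_forall_Ico_nat`: classical on `[0, N + 1)` for all `N` ⇒
  classical on `[0, ∞)`.
* `IsTaoSolutionOn.eq_of_lt_of_lt`, `IsTaoSolutionOn.floor_eq`: consistency of a family of
  Tao-class solutions from one datum.
* `IsTaoSolutionOn.global_of_nat`: the global classical solution with bounded energy.

## Mathlib / tree search

`lean search 'global_of|of_forall_Ico|congr_slices|IsTaoSolutionOn'`: the tree has the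
Tao-class bookkeeping of `TaoClassGlue.lean` (restriction, translation, uniqueness, pressure
determination, gluing of two slabs) and the half-open gluing of `ClassicalSolutionGlue.lean`;
no exhaustion lemma to `Ici 0`. Mathlib: `contDiffOn_of_locally_contDiffOn`, `derivWithin_inter`,
`derivWithin_congr`, `Nat.lt_floor_add_one`, `Nat.floor_zero`.

## References

* P. G. Lemarié-Rieusset, *The Navier–Stokes Problem in the 21st Century*, CRC Press 2016,
  Thm. 7.2 (proof, p. 147) and Thm. 10.4 (p. 285). [LemarieRieusset2016]
* T. Tao, Anal. PDE 6 (2013) = arXiv:1108.1165, Thm. 5.4 and Cor. 35 (arXiv numbering).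
* C. L. Fefferman, *Existence and smoothness of the Navier–Stokes equation* (Clay 2006), (A).
-/

noncomputable section

open MeasureTheory Set Function Filter Topology
open scoped ENNReal NNReal ContDiff

namespace Literature.Analysis.FluidPDE

/-! ### Two lemmas on classical solutions -/

section Classical

variable {E : Type*} [NormedAddCommGroup E] [InnerProductSpace ℝ E] [FiniteDimensional ℝ E]
variable {S : Set ℝ} {ν : ℝ} {f u u' : ℝ → E → E} {p p' : ℝ → E → ℝ}

/-- **Being a classical solution on `S` only depends on the slices `u t`, `p t`, `t ∈ S`**: the
joint smoothness is on `S × E`, the one-sided time derivative within `S` at `t ∈ S` only sees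
the time lines on `S` (`derivWithin_congr`), and the equations are imposed at `t ∈ S`. [folklore] -/
theorem IsClassicalNSSolutionOn.congr_slices (h : IsClassicalNSSolutionOn S ν f u p)
    (hu : ∀ t ∈ S, u' t = u t) (hp : ∀ t ∈ S, p' t = p t) :
    IsClassicalNSSolutionOn S ν f u' p' where
  smooth_velocity := by
    refine h.smooth_velocity.congr fun z hz => ?_
    obtain ⟨t, x⟩ := z
    simp only [uncurry_apply_pair, hu t hz.1]
  smooth_pressure := by
    refine h.smooth_pressure.congr fun z hz => ?_
    obtain ⟨t, x⟩ := z
    simp only [uncurry_apply_pair, hp t hz.1]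
  momentum t ht x := by
    have hD : timeDerivWithin S u' t x = timeDerivWithin S u t x := by
      simp only [timeDerivWithin_apply]
      exact derivWithin_congr (fun s hs => congrFun (hu s hs) x) (congrFun (hu t ht) x)
    rw [hD, hu t ht, hp t ht]
    exact h.momentum t ht x
  divFree t ht := by
    rw [hu t ht]
    exact h.divFree t ht

/-- **Exhaustion of `[0, ∞)` by `[0, N + 1)` for joint smoothness**: a field jointly smooth on
`[0, N + 1) × X` for every `N : ℕ` is jointly smooth on `[0, ∞) × X` (smoothness within a set
is local, `contDiffOn_of_locally_contDiffOn`, and `[0, N + 1) × X` is relatively open in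
`[0, ∞) × X`). [folklore] -/
theorem IsSmoothSpaceTimeOn.of_forall_Ico_nat {X : Type*} [NormedAddCommGroup X]
    [NormedSpace ℝ X] {F : Type*} [NormedAddCommGroup F] [NormedSpace ℝ F] {w : ℝ → X → F}
    (hw : ∀ N : ℕ, IsSmoothSpaceTimeOn (Ico 0 ((N : ℝ) + 1)) w) :
    IsSmoothSpaceTimeOn (Ici 0) w := by
  refine contDiffOn_of_locally_contDiffOn fun z hz => ?_
  obtain ⟨t, x⟩ := z
  refine ⟨Iio ((⌊t⌋₊ : ℝ) + 1) ×ˢ univ, isOpen_Iio.prod isOpen_univ,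
    ⟨Nat.lt_floor_add_one t, mem_univ _⟩, ?_⟩
  rw [prod_inter_prod, Ici_inter_Iio, inter_self]
  exact hw ⌊t⌋₊

/-- **Exhaustion of `[0, ∞)` by the half-open slabs `[0, N + 1)`**: if `(u, p)` is a classical
solution on `[0, N + 1) × E` for every `N : ℕ`, it is a classical solution on `[0, ∞) × E`.
Joint smoothness on `[0, ∞) × E` is local and each `[0, N + 1) × E` is relatively open
(`IsSmoothSpaceTimeOn.of_forall_Ico_nat`); the one-sided time derivative within `[0, ∞)` at `t`
equals the one within `[0, N + 1)` for `t < N + 1` (`derivWithin_inter`, `N = ⌊t⌋₊`)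
(Beale–Kato–Majda 1984, §1: the interval of smooth existence). [folklore] -/
theorem IsClassicalNSSolutionOn.of_forall_Ico_nat
    (h : ∀ N : ℕ, IsClassicalNSSolutionOn (Ico 0 ((N : ℝ) + 1)) ν f u p) :
    IsClassicalNSSolutionOn (Ici 0) ν f u p := by
  refine ⟨IsSmoothSpaceTimeOn.of_forall_Ico_nat fun N => (h N).smooth_velocity,
    IsSmoothSpaceTimeOn.of_forall_Ico_nat fun N => (h N).smooth_pressure, ?_, ?_⟩
  · intro t ht x
    have htN : t < (⌊t⌋₊ : ℝ) + 1 := Nat.lt_floor_add_one t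
    have hD : timeDerivWithin (Ici 0) u t x = timeDerivWithin (Ico 0 ((⌊t⌋₊ : ℝ) + 1)) u t x := by
      simp only [timeDerivWithin_apply]
      rw [← derivWithin_inter (Iio_mem_nhds htN), Ici_inter_Iio]
    rw [hD]
    exact (h ⌊t⌋₊).momentum t ⟨ht, htN⟩ x
  · intro t ht
    exact (h ⌊t⌋₊).divFree t ⟨ht, Nat.lt_floor_add_one t⟩

end Classical

/-! ### Consistent families of Tao-class solutions and the global solution -/

namespace IsTaoSolutionOn

variable {ν : ℝ} {u₀ : EuclideanSpace ℝ (Fin 3) → EuclideanSpace ℝ (Fin 3)}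
  {U : ℕ → ℝ → EuclideanSpace ℝ (Fin 3) → EuclideanSpace ℝ (Fin 3)}
  {P : ℕ → ℝ → EuclideanSpace ℝ (Fin 3) → ℝ}

/-- **Consistency of Tao-class solutions from one datum.** If `(U n, P n)` is a Tao-class
solution on `[0, n + 1]` from `u₀` for every `n`, then `U n t = U m t` and `P n t = P m t`
whenever `0 ≤ t < n + 1` and `t < m + 1`: the velocities agree on the common half-open slab by
Prodi–Serrin weak–strong uniqueness (`eq_of_isTaoSolutionOn`), hence on the closed slab
`[0, s]`, `s = (t + min (n+1) (m+1))/2`, and then the `L²` pressures agree there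
(`pressure_eq`). [cite: RobinsonRodrigoSadowski2016, Thm. 8.19] -/
theorem eq_of_lt_of_lt (hU : ∀ n : ℕ, IsTaoSolutionOn ((n : ℝ) + 1) ν u₀ (U n) (P n))
    (hν : 0 < ν) {n m : ℕ} {t : ℝ} (ht0 : 0 ≤ t) (htn : t < (n : ℝ) + 1)
    (htm : t < (m : ℝ) + 1) : U n t = U m t ∧ P n t = P m t := by
  have hn : (0 : ℝ) < (n : ℝ) + 1 := by positivity
  have hm : (0 : ℝ) < (m : ℝ) + 1 := by positivity
  have hV : ∀ s ∈ Ico 0 (min ((n : ℝ) + 1) ((m : ℝ) + 1)), U n s = U m s :=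
    eq_of_isTaoSolutionOn (hU n) (hU m) hν hn hm
  refine ⟨hV t ⟨ht0, lt_min htn htm⟩, ?_⟩
  -- a closed slab `[0, s]` with `t ≤ s < min (n+1) (m+1)`
  set μ : ℝ := min ((n : ℝ) + 1) ((m : ℝ) + 1) with hμ
  have htμ : t < μ := lt_min htn htm
  set s : ℝ := (t + μ) / 2 with hs
  have hs0 : 0 < s := by rw [hs]; linarith
  have hsμ : s < μ := by rw [hs]; linarith
  have hts : t ≤ s := by rw [hs]; linarith
  have hsn : s ≤ (n : ℝ) + 1 := (hsμ.trans_le (min_le_left _ _)).le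
  have hsm : s ≤ (m : ℝ) + 1 := (hsμ.trans_le (min_le_right _ _)).le
  have hVs : ∀ r ∈ Icc 0 s, U n r = U m r := fun r hr => hV r ⟨hr.1, hr.2.trans_lt hsμ⟩
  exact pressure_eq (hU n) (hU m) hs0 hsn hsm hVs t ⟨ht0, hts⟩

/-- On `[0, N + 1)` the floor-indexed fields `t ↦ U ⌊t⌋₊ t`, `t ↦ P ⌊t⌋₊ t` coincide with
`(U N, P N)` (`eq_of_lt_of_lt` with `t < ⌊t⌋₊ + 1`). [folklore] -/
theorem floor_eq (hU : ∀ n : ℕ, IsTaoSolutionOn ((n : ℝ) + 1) ν u₀ (U n) (P n)) (hν : 0 < ν)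
    (N : ℕ) {t : ℝ} (ht : t ∈ Ico 0 ((N : ℝ) + 1)) :
    U ⌊t⌋₊ t = U N t ∧ P ⌊t⌋₊ t = P N t :=
  eq_of_lt_of_lt hU hν ht.1 (Nat.lt_floor_add_one t) ht.2

/-- **From Tao-class solutions on every `[0, n + 1]` to a global classical solution with
bounded energy.** Let `ν > 0` and let `(U n, P n)` be a Tao-class solution on `[0, n + 1]` from
`u₀` for every `n : ℕ`. Then `u t := U ⌊t⌋₊ t`, `p t := P ⌊t⌋₊ t` is a classical solution of
the unforced Navier–Stokes system on `[0, ∞) × ℝ³` (jointly smooth up to `t = 0`) with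
`u 0 = u₀` and `∫ |u(t)|² ≤ ∫ |u₀|²` for all `t ≥ 0` (`HasBoundedEnergy`): on each `[0, N + 1)`
the pair equals `(U N, P N)` (`floor_eq`), a classical solution there, so it is classical on
`[0, ∞)` (`IsClassicalNSSolutionOn.of_forall_Ico_nat`); the energy bound is the Leray–Hopf
energy inequality of the Tao-class solutions (`lintegral_enorm_sq_le`). This is the concluding
step "the maximal time is `+∞`" of Lemarié-Rieusset 2016, Thm. 10.4 / Thm. 7.2, and of Tao
2013, Cor. 35, once local solutions exist on slabs of every length. [cite: LemarieRieusset2016, Thm. 10.4 (p. 285) with Thm. 7.2 (proof, p. 147)] -/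
theorem global_of_nat (hU : ∀ n : ℕ, IsTaoSolutionOn ((n : ℝ) + 1) ν u₀ (U n) (P n))
    (hν : 0 < ν) :
    IsClassicalNSSolutionOn (Ici 0) ν 0 (fun t => U ⌊t⌋₊ t) (fun t => P ⌊t⌋₊ t) ∧
      (fun t => U ⌊t⌋₊ t) 0 = u₀ ∧ HasBoundedEnergy (fun t => U ⌊t⌋₊ t) := by
  refine ⟨?_, ?_, ?_⟩
  · refine IsClassicalNSSolutionOn.of_forall_Ico_nat fun N => ?_
    have hN : (0 : ℝ) < (N : ℝ) + 1 := by positivity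
    have hcl : IsClassicalNSSolutionOn (Ico 0 ((N : ℝ) + 1)) ν 0 (U N) (P N) :=
      (hU N).classical.mono Ico_subset_Icc_self (uniqueDiffOn_Ico 0 _)
    exact hcl.congr_slices (fun t ht => (floor_eq hU hν N ht).1)
      fun t ht => (floor_eq hU hν N ht).2
  · show U ⌊(0 : ℝ)⌋₊ 0 = u₀
    rw [Nat.floor_zero]
    exact (hU 0).initial
  · refine ⟨ENNReal.ofReal (2 * VectorCalculus.kineticEnergy u₀), ENNReal.ofReal_lt_top,
      fun t ht => ?_⟩
    have hN : (0 : ℝ) < (⌊t⌋₊ : ℝ) + 1 := by positivity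
    exact (hU ⌊t⌋₊).lintegral_enorm_sq_le hN hν.le ⟨ht, (Nat.lt_floor_add_one t).le⟩

end IsTaoSolutionOn

end Literature.Analysis.FluidPDE

end
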